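import Summits.CriticalPhenomena.SAWScalingLimit.Theses.SAWRenewalTightness
import Summits.CriticalPhenomena.SAWScalingLimit.Theorems.ShellCrossingBound.Negative.Forcing6Shell
import Summits.CriticalPhenomena.SAWScalingLimit.Theorems.ShellCrossingBound.Negative.OfEventualTight
import Summits.CriticalPhenomena.SAWScalingLimit.Theorems.ShellCrossingBound.Negative.RadiiThreshold
import Summits.CriticalPhenomena.SAWScalingLimit.Theorems.ShellCrossingBound.Negative.BulkThresholdTwo

/-!
# Disproof of `ShellCrossingBound` — findings (cdisprove, crux stmt-CriticalPhenomena-4728)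

Standing adversary file for the crux `SAWRenewalTightness.ShellCrossingBound` (route
`route-CriticalPhenomena-SAWRenewalTightness`, sub-problem `SAWScalingLimit`). Prose lives in
docstrings; every `theorem` without `sorry` is checked.

## Verdict of cycle 1: NO KILL of the crux (it is implied by the route's own target); its natural strengthening (uniform threshold) KILLED in Lean

(This mechanises, sorry-free, the paper REMARK left on the item by the route-review refuter,
2026-08-15: "with k(x,ρ,R) existential per shell and K, λ fixed, ShellCrossingBound is
equivalent to EventualTight". Cited from the item notes of stmt-CriticalPhenomena-4728.)

* `shellCrossingBound_of_eventualTight` (§2, fully proved):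
  `EventualTight → ShellCrossingBound`. Because the threshold `k : ℂ → ℝ → ℝ → ℕ` is chosen
  PER SHELL after `D, a, b` are fixed, while only `K, λ` are uniform, the bound for a fixed shell
  `S = D(x; ρ, R)` only asks `sup_{δ ≤ δ₀} P_δ[k(S) separate traversals of S] ≤ K (ρ/R)^λ`, and
  `k(S)` may be astronomically large. Tightness of the pushed-forward laws on `CurveClass ℂ`
  gives exactly this: on a compact set of curve classes the number of separate traversals of a
  genuine shell is bounded (`exists_forall_not_hasTraversals_of_isCompact`, from
  `Curve.exists_not_hasTraversals` + stability of traversals under the reparametrisation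
  distance, §1), so `k(S)` := that bound for a compact set carrying all but `(ρ/R)^3` of the mass.
* Hence (with the support item `TightOfShellCrossing : ShellCrossingBound → EventualTight`,
  the proved Aizenman–Burchard criterion) `ShellCrossingBound ⟺ EventualTight`: a disproof of the
  crux is a disproof of tightness of the critical `ℤ²` SAW laws, i.e. of the conjunct
  `SAWScalingLimit` itself ("major news", in the route's own words). No cheap kill exists.
* `radiiThreshold_of_eventualTight` (§2b, proved): under the target the threshold may depend on
  the RADII only, uniformly in the centre `x` — the `x`-dependence is decorative too. Hence the
  trichotomy: `k(x,ρ,R)` or `k(ρ,R)` ⟸ T′; `k` uniform in the radii ⟹ FALSE near `∂Ω` (§4);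
  content can only sit in radii-uniformity on interior shells (§5).
* `anyTarget_of_eventualTight` / `ShellCrossingBoundAnyExponent` (§2–§3): the Aizenman–Burchard
  dress (`K`, `λ > 2`, `δ ≤ ρ`, `R ≤ 1`) is NOT load-bearing: given `EventualTight`, ANY positive
  shell-dependent target `f x ρ R` is met, for all shells `0 < ρ < R` (no mesh lower bound, no
  `R ≤ 1`), in particular `K (ρ/R)^λ` for every `K > 0` and every real `λ`. Message to provers /
  planner: proving r2 through r3–r4 (`SurgeryReduction`) is proving tightness itself; the power
  law carries no extra information in this typing. A crux with CONTENT beyond T′ would fix the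
  threshold's dependence, e.g. `k x ρ R ≤ k₀` for shells at distance `≥ R` from `∂Ω ∪ {a,b}`
  (bulk AB (H1)), which is what Hölder regularity / dimension bounds (AB99 Thm 1.1–1.3) need.

## Verdict of cycle 2 (gen 2): still NO KILL of the crux; the fixed-threshold BULK repair is FALSE for `k₀ ≤ 2` (Lean, estimate-free) — interior endpoints are load-bearing

* NEW (§5b, `not_shellCrossingBoundBulkAt_of_le_two`; LANDED as
  `Theorems/ShellCrossingBound/Negative/BulkEndpoint.lean` (p80596) + `BulkThresholdTwo.lean` (p81467)): the repair candidate
  `ShellCrossingBoundBulk` (§5) with its threshold pinned to any `k₀ ≤ 2` is FALSE. Witness: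
  `SAW.IsEndpointApprox` only asks `δ·b_δ → b`, so `b_δ` may be INTERIOR at distance `≍ √δ ≫ δ`
  from `∂Ω` (`Negative.Bulk.bInt` on cycle 1's `forcingDomain`, joined to cycle 1's `aδ`); every
  SAW polyline ends at `q = δ·b_δ`, crosses the circle `|z − q| = √δ/16`, hence passes within
  `ρ = δ` of one of `≤ 324/u²` points of a grid of step `δ/2` (`u = 32√δ`), making TWO separate
  traversals of the interior shell `D(x; δ, √δ/32) ⊆ Ω` there; the union bound gives
  `1 ≤ 324 K u^{λ−2} → 0`. So a fixed-threshold bulk crux needs `k₀ ≥ 3`; `k₀ = 3` is predicted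
  false by the return exponent `x₃ − x₁ = 3/2 < 2` at the interior start (not provable today);
  `k₀ = 4` predicted true. ALTERNATIVE REPAIR: guard the marked points as the pinch line's `UTSP`
  does (centres at distance `≥ d` from `D.pt 0, D.pt 1`, constants depending on `d`): the
  interior-endpoint witness is then absorbed (for `δ ≤ δ(d)` the endpoint is within `d` of `b`;
  for `δ ≥ δ(d)` the ratio `ρ/R ≥ δ(d)` is bounded below), and `k₀ = 2` guarded is predicted false
  (`(ρ/R)^{x₂} = (ρ/R)^{2/3}`) but not refutable estimate-free.
* Junk hunt on the ideators' atoms (paper, recorded for the lead): `UTSP` (pinch-on-a-circle)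
  survives sub-mesh (`η < δ/2` ⇒ event needs ratio `≥ 1/√2`), interior-endpoint (absorbed by
  `C(d)`), fjord (`e^{−cℓ/w} ≪ (w/ℓ)^{1+s}`) and neck attacks (cross-cuts of vanishing length
  accumulate only at `a` or `b`); `NonDegeneracyEta` (cell polyominoes, time zero) survives
  sub-mesh attacks (the `sphere ∩ frontier` clause plus the `δ/2` clearance of the walk from `∂U`;
  dead-end cells are continuum-forced too); `PerShellTight`, `PerShellDecay` are `⟺ T′` by §2.
  No Lean kill available there; the crux itself stays `⟺ EventualTight`.

## Load-bearing analysis (§3)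
* `IsEndpointApprox` (the only external hypothesis): dropping it leaves
  `ShellCrossingBoundWithoutApprox`, still implied by tightness of the SAW laws uniformly over
  arbitrary endpoint functions (`withoutApprox_of_tight`); not refutable by junk endpoints:
  coincident endpoints give the constant curve (no traversal of a genuine shell,
  `Curve.not_hasTraversals_const`), unreachable ones the zero law. No `_false_without_` theorem
  is available for any hypothesis — recorded as a finding, not a gap.
* Side conditions `δ ≤ ρ`, `R ≤ 1`, `2 < λ`: decorative (§2).
* Deterministic boundary forcing (fjords, zigzag corridors near `a`) is absorbed by the
  shell-dependent `k`: a Jordan boundary makes finitely many excursions across any fixed genuine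
  shell (`Curve.exists_not_hasTraversals` applied to the boundary loop), so the number of
  traversals it can force is bounded per shell, uniformly in `δ`; thin corridors invisible to
  `δℤ²` only truncate `Ω_δ` (largest component) and cannot force detours in a simply connected
  domain (a detour and the direct route bound a region of `Ω`, through which the lattice path
  shortcuts). Paper argument; consistent with §2, which makes it unnecessary.

## Natural strengthenings (§4) — the uniform-threshold AB hypothesis is FALSE (sorry-free)
* `ShellCrossingBoundUniformK` (threshold independent of the shell — the literal AB (H1)) is
  REFUTED: `not_shellCrossingBoundUniformK`, fully proved (no sorry in this file any more).
  Reduction `not_uniformK_of_forcing` + the explicit construction `exists_hasForcingCorridors`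
  (LANDED: `Theorems/ShellCrossingBound/Negative/Forcing1Domain … Forcing6Shell.lean`; conclusion `Negative.not_uniformThreshold` in `UniformThresholdFalse.lean`): the triangle
  `(0, 1 ∓ i/4)` sheared along the damped topologist's sine `√x · sin(π/x)` (a Dobrushin domain
  via the tree's `triangleRectangle`, `MarkedDomain.chord/map`), its carrier identified exactly,
  the largest-component discrete domain settled by a counting injection, the endpoint
  approximation `a_δ` = first resolved spine point `→ 0`, and forcing by the intermediate value
  theorem across `2k+1` alternating turning abscissae `u_j = 2/((2L+1)²+4k−2j)`. Being landed as
  `Theorems/ShellCrossingBound/Negative/Forcing*.lean` + `UniformThresholdFalse.lean` (≤ 400-line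
  parts, review-queued because of the definitions). Consequence for repairs: uniformity of the
  threshold can only be asked on interior shells (§5 `ShellCrossingBoundBulk`).

## Repair candidates for the planner (§5)
* `ShellCrossingBoundBulk` (ONE threshold `k₀` on shells with `closedBall x R ⊆ Ω`: AB (H1)
  proper in the bulk — content beyond T′, immune to forcing, predicted with `k₀ = 4`) and
  `ShellCrossingBoundBoundary` (shell-dependent threshold on shells meeting `Ωᶜ`; implied by T′,
  `boundary_of_eventualTight`). PROVED glue `shellCrossingBound_of_bulk_of_boundary`:
  Bulk ∧ Boundary → ShellCrossingBound (thresholds by `max`, constants by `max`, exponents by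
  `min`), so `route edit --split ShellCrossingBound --into …Bulk …Boundary` keeps the assembly and
  gives r2 a content-bearing half at which the surgery (r3, r4, SurgeryReduction) can be aimed.
  CYCLE 2: any proof of the bulk half must produce `k₀ ≥ 3` (§5b); do not aim at `k₀ ≤ 3`.

## Dead ends (one line each)
* all-`δ` variant (`δ ∈ (0,1]` instead of `∃ δ₀`): there `ρ/R ≥ δ ≥ δ₀`-type lower bounds let
  `K` absorb everything; the 0772 witness (far coincident endpoints) produces constant curves,
  which traverse nothing.
* junk law (`law = 0` when unreachable): satisfies every upper bound.
* `k x ρ R = 0`: `HasTraversals 0` is `True`, but `k` is the prover's choice.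
* negative `K`: `ofReal` clips to `0`; `K` is existential, irrelevant.
* (cycle 2) `k₀ = 3` bulk kill: needs a LOWER bound on a SAW return/revisit probability — no
  estimate-free handle (start and end shells force only 1 traversal each; grid pigeonhole forces 2).
* (cycle 2) marked-point-guarded bulk statement (`UTSP`-style): interior-endpoint witness absorbed by `C(d)`.
* (cycle 2) `KSConditionG2` (stmt-0791, sibling route) is refuted on paper by the triage panel's
  start-gap witness; Lean mechanisation (≈ 1500 lines: stopAt/startFrom, unforcedPart topology)
  deferred — the SAWParafermion planner has announced `--drop KSConditionG2`.

-- Targets: none yet (payload.targets = [], stuck_stubs = []; no line picked as of cycle 2).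
-/

noncomputable section

open Set Filter Topology Metric MeasureTheory
open scoped ENNReal Real
open Literature.Probability.RandomPlanarGeometry Literature.Probability.LatticeModels

namespace Summit.CriticalPhenomena.SAWScalingLimit.Cruxes.ShellCrossingBound.Disproof

open scoped unitInterval

open Summit.CriticalPhenomena.SAWScalingLimit.Theses.SAWRenewalTightness

/-! ## §1 Deterministic stability of separate traversals -/

section Stability

variable {E : Type*} [PseudoMetricSpace E]

/-- Separate traversals are invariant under increasing reparametrisation. [folklore] -/
theorem hasTraversals_reparam_iff (γ : Curve E) (φ : I ≃o I) (k : ℕ) (x : E) (r R : ℝ) :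
    (γ.reparam φ).HasTraversals k x r R ↔ γ.HasTraversals k x r R := by
  constructor
  · rintro ⟨s, t, hst, hsep⟩
    refine ⟨φ ∘ s, φ ∘ t, fun i => ?_, fun i j hij => φ.lt_iff_lt.2 (hsep hij)⟩
    obtain ⟨hle, h⟩ := hst i
    exact ⟨φ.le_iff_le.2 hle, by simpa [Curve.reparam_apply] using h⟩
  · rintro ⟨s, t, hst, hsep⟩
    refine ⟨φ.symm ∘ s, φ.symm ∘ t, fun i => ?_, fun i j hij => φ.symm.lt_iff_lt.2 (hsep hij)⟩
    obtain ⟨hle, h⟩ := hst i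
    refine ⟨φ.symm.le_iff_le.2 hle, ?_⟩
    simpa [Curve.IsTraversal, Curve.reparam_apply, OrderIso.apply_symm_apply] using h

/-- Perturbation: if two parametrised curves are at sup distance `≤ η`, then `k` separate
traversals of `D(x; r, R)` by the second give `k` separate traversals of the shrunk shell
`D(x; r + η, R - η)` by the first (same parameter intervals). [folklore] -/
theorem hasTraversals_of_dist_toContinuousMap_le {γ₁ γ₂ : Curve E} {η : ℝ}
    (h : dist γ₁.toContinuousMap γ₂.toContinuousMap ≤ η) {k : ℕ} {x : E} {r R : ℝ}
    (h₂ : γ₂.HasTraversals k x r R) : γ₁.HasTraversals k x (r + η) (R - η) := by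
  obtain ⟨s, t, hst, hsep⟩ := h₂
  refine ⟨s, t, fun i => ?_, hsep⟩
  obtain ⟨hle, hor⟩ := hst i
  have hd : ∀ u : I, dist (γ₁ u) (γ₂ u) ≤ η := fun u =>
    (ContinuousMap.dist_apply_le_dist (f := γ₁.toContinuousMap) (g := γ₂.toContinuousMap) u).trans h
  refine ⟨hle, ?_⟩
  rcases hor with ⟨h1, h2⟩ | ⟨h1, h2⟩
  · left
    constructor
    · linarith [dist_triangle (γ₁ (s i)) (γ₂ (s i)) x, hd (s i)]
    · linarith [dist_triangle (γ₂ (t i)) (γ₁ (t i)) x, hd (t i), dist_comm (γ₁ (t i)) (γ₂ (t i))]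
  · right
    constructor
    · linarith [dist_triangle (γ₂ (s i)) (γ₁ (s i)) x, hd (s i), dist_comm (γ₁ (s i)) (γ₂ (s i))]
    · linarith [dist_triangle (γ₁ (t i)) (γ₂ (t i)) x, hd (t i)]

/-- Perturbation in the reparametrisation distance: curves at distance `< η` have the same
number of separate traversals up to shrinking the shell by `η` on each side. [folklore] -/
theorem hasTraversals_of_dist_lt {γ₁ γ₂ : Curve E} {η : ℝ} (h : dist γ₁ γ₂ < η) {k : ℕ} {x : E}
    {r R : ℝ} (h₂ : γ₂.HasTraversals k x r R) : γ₁.HasTraversals k x (r + η) (R - η) := by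
  obtain ⟨φ, hφ⟩ := Curve.exists_dist_reparam_lt h
  exact hasTraversals_of_dist_toContinuousMap_le hφ.le ((hasTraversals_reparam_iff γ₂ φ k x r R).2 h₂)

/-- **On a compact set of curve classes the number of separate traversals of a genuine shell is
bounded.** If not, pick `γₙ` in the set with `n` traversals of `D(x; r, R)`; a subsequence
converges to some class `[γ₀]`; but `γ₀` traverses the shrunk shell `D(x; r + η, R - η)`,
`η = (R - r)/3`, only `< k₀` times (`Curve.exists_not_hasTraversals`), while every `γₙ` close to
`γ₀` with `n ≥ k₀` transfers `k₀` traversals to it (`hasTraversals_of_dist_lt`). [folklore] -/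
theorem exists_forall_not_hasTraversals_of_isCompact {𝒦 : Set (CurveClass E)}
    (h𝒦 : IsCompact 𝒦) (x : E) {r R : ℝ} (hrR : r < R) :
    ∃ k, ∀ γ : Curve E, CurveClass.mk γ ∈ 𝒦 → ¬ γ.HasTraversals k x r R := by
  by_contra hcon
  push Not at hcon
  choose γ hγmem hγtrav using hcon
  obtain ⟨c, -, φ, hφ, hlim⟩ := h𝒦.isSeqCompact hγmem
  obtain ⟨γ₀, rfl⟩ := CurveClass.surjective_mk c
  set η : ℝ := (R - r) / 3 with hη
  have hη0 : 0 < η := by rw [hη]; linarith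
  obtain ⟨k₀, hk₀⟩ :=
    Curve.exists_not_hasTraversals γ₀ x (r := r + η) (R := R - η) (by rw [hη]; linarith)
  rw [Metric.tendsto_atTop] at hlim
  obtain ⟨N, hN⟩ := hlim η hη0
  have hn := hN (max N k₀) (le_max_left _ _)
  simp only [Function.comp_apply, CurveClass.mk_eq_separationQuotientMk,
    SeparationQuotient.dist_mk] at hn
  have htrav : (γ (φ (max N k₀))).HasTraversals k₀ x r R :=
    (hγtrav _).of_le ((le_max_right N k₀).trans (hφ.id_le _))
  rw [dist_comm] at hn
  exact hk₀ (hasTraversals_of_dist_lt hn htrav)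

end Stability

/-! ## §2 The sandwich: tightness already gives every shell bound -/

/-- **Tightness ⇒ arbitrary shell-dependent crossing bounds.** If the pushed-forward SAW laws
`(law Ω δ (a δ) (b δ)).map curve`, `δ ∈ T`, form a tight set, then for EVERY target
`f : ℂ → ℝ → ℝ → ℝ≥0∞`, positive on genuine shells `0 < ρ < R`, there is a shell-dependent
threshold `k` with `P_δ[k x ρ R separate traversals of D(x; ρ, R)] ≤ f x ρ R` for all `δ ∈ T`
and all genuine shells — no mesh lower bound `δ ≤ ρ`, no `R ≤ 1`, endpoints arbitrary.
Proof: tightness gives a compact `𝒦 ⊆ CurveClass ℂ` carrying all but `f x ρ R` of every law;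
take `k` from `exists_forall_not_hasTraversals_of_isCompact`. [folklore] -/
theorem targets_of_isTightMeasureSet (Ω : Set ℂ) (a b : ℝ → Site 2) (T : Set ℝ)
    (htight : IsTightMeasureSet
      ((fun δ => (SAW.law Ω δ (a δ) (b δ)).map (fun γ => γ.curve)) '' T))
    (f : ℂ → ℝ → ℝ → ℝ≥0∞) (hf : ∀ x ρ R, 0 < ρ → ρ < R → f x ρ R ≠ 0) :
    ∃ k : ℂ → ℝ → ℝ → ℕ, ∀ δ ∈ T, ∀ (x : ℂ) (ρ R : ℝ), 0 < ρ → ρ < R →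
      SAW.law Ω δ (a δ) (b δ)
        {γ | (⟨γ.walk.toCurve (meshPoint δ)⟩ : Curve ℂ).HasTraversals (k x ρ R) x ρ R} ≤ f x ρ R := by
  rw [isTightMeasureSet_iff_exists_isCompact_measure_compl_le] at htight
  have key : ∀ (x : ℂ) (ρ R : ℝ), ∃ k : ℕ, 0 < ρ → ρ < R → ∀ δ ∈ T,
      SAW.law Ω δ (a δ) (b δ)
        {γ | (⟨γ.walk.toCurve (meshPoint δ)⟩ : Curve ℂ).HasTraversals k x ρ R} ≤ f x ρ R := by
    intro x ρ R
    by_cases hρR : 0 < ρ ∧ ρ < R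
    · obtain ⟨𝒦, h𝒦, hμ⟩ := htight (f x ρ R) (pos_iff_ne_zero.2 (hf x ρ R hρR.1 hρR.2))
      obtain ⟨k, hk⟩ := exists_forall_not_hasTraversals_of_isCompact h𝒦 x hρR.2
      refine ⟨k, fun _ _ δ hδ => ?_⟩
      calc SAW.law Ω δ (a δ) (b δ)
            {γ | (⟨γ.walk.toCurve (meshPoint δ)⟩ : Curve ℂ).HasTraversals k x ρ R}
          ≤ SAW.law Ω δ (a δ) (b δ) ((fun γ => γ.curve) ⁻¹' 𝒦ᶜ) := by
            refine measure_mono fun γ hγ => ?_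
            exact fun hmem => hk _ hmem hγ
        _ ≤ ((SAW.law Ω δ (a δ) (b δ)).map (fun γ => γ.curve)) 𝒦ᶜ :=
            Measure.le_map_apply (SAW.aemeasurable_curve _ _ _ _) _
        _ ≤ f x ρ R := hμ _ ⟨δ, hδ, rfl⟩
    · exact ⟨0, fun h1 h2 => absurd ⟨h1, h2⟩ hρR⟩
  choose k hk using key
  exact ⟨k, fun δ hδ x ρ R hρ hρR => hk x ρ R hρ hρR δ hδ⟩

/-- **Every positive shell-dependent target is met under `EventualTight`.** For every Dobrushin
domain and endpoint approximation, with the `δ₀` of `EventualTight`: for every target `f`,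
positive on genuine shells, some shell-dependent threshold achieves
`P_δ[k x ρ R traversals] ≤ f x ρ R` for all `δ ∈ (0, δ₀]`, all `x`, all `0 < ρ < R`. [folklore] -/
theorem anyTarget_of_eventualTight (hT : EventualTight) (D : DobrushinDomain) (a b : ℝ → Site 2)
    (hab : SAW.IsEndpointApprox D a b) :
    ∃ δ₀ : ℝ, 0 < δ₀ ∧ ∀ f : ℂ → ℝ → ℝ → ℝ≥0∞, (∀ x ρ R, 0 < ρ → ρ < R → f x ρ R ≠ 0) →
      ∃ k : ℂ → ℝ → ℝ → ℕ, ∀ δ ∈ Set.Ioc (0 : ℝ) δ₀, ∀ (x : ℂ) (ρ R : ℝ), 0 < ρ → ρ < R →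
        SAW.law D.carrier δ (a δ) (b δ)
          {γ | (⟨γ.walk.toCurve (meshPoint δ)⟩ : Curve ℂ).HasTraversals (k x ρ R) x ρ R} ≤ f x ρ R := by
  obtain ⟨δ₀, hδ₀, htight⟩ := hT D a b hab
  exact ⟨δ₀, hδ₀, fun f hf => targets_of_isTightMeasureSet D.carrier a b _ htight f hf⟩

/-- **The crux is implied by the route's target**: `EventualTight → ShellCrossingBound`, with
`K = 1`, `λ = 3` and the `δ₀` of `EventualTight`. Consequently (with the support item
`TightOfShellCrossing`) `ShellCrossingBound ⟺ EventualTight`, and `¬ ShellCrossingBound` would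
refute tightness of the critical `ℤ²` SAW laws, i.e. the conjunct itself. This is WHY the crux
resists disproof. [folklore] -/
theorem shellCrossingBound_of_eventualTight (hT : EventualTight) : ShellCrossingBound := by
  intro D a b hab
  obtain ⟨δ₀, hδ₀, H⟩ := anyTarget_of_eventualTight hT D a b hab
  obtain ⟨k, hk⟩ := H (fun x ρ R => ENNReal.ofReal (1 * (ρ / R) ^ (3 : ℝ))) (by
    intro x ρ R hρ hρR
    have hR : 0 < R := hρ.trans hρR
    have : 0 < 1 * (ρ / R) ^ (3 : ℝ) := by
      rw [one_mul]
      exact Real.rpow_pos_of_pos (div_pos hρ hR) _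
    exact (ENNReal.ofReal_pos.2 this).ne')
  refine ⟨k, 1, 3, δ₀, by norm_num, hδ₀, fun δ hδ x ρ R hδρ hρR _ => ?_⟩
  exact hk δ hδ x ρ R (hδ.1.trans_le hδρ) hρR

/-- Contrapositive packaging for the record: a disproof of the crux disproves the target.
[folklore] -/
theorem not_eventualTight_of_not_shellCrossingBound (h : ¬ ShellCrossingBound) : ¬ EventualTight :=
  fun hT => h (shellCrossingBound_of_eventualTight hT)

/-- With the support item `TightOfShellCrossing` (stmt-CriticalPhenomena-4732, the proved AB
criterion applied to SAW polylines) the crux and the target are EQUIVALENT. [folklore] -/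
theorem shellCrossingBound_iff_eventualTight (h : TightOfShellCrossing) :
    ShellCrossingBound ↔ EventualTight :=
  ⟨h, shellCrossingBound_of_eventualTight⟩

/-! ## §2b Even the centre-dependence of the threshold is decorative (LANDED: `Negative/RadiiThreshold.lean`, p75627) -/

/-- Under the target the threshold may depend on the RADII only, uniformly in the centre `x`
(re-export of the landed `Negative.radiiThreshold_of_eventualTight`). [folklore] -/
theorem radiiThreshold_of_eventualTight' (hT : EventualTight) (D : DobrushinDomain) (a b : ℝ → Site 2)
    (hab : SAW.IsEndpointApprox D a b) :
    ∃ (k : ℝ → ℝ → ℕ) (δ₀ : ℝ), 0 < δ₀ ∧ ∀ δ ∈ Set.Ioc (0 : ℝ) δ₀, ∀ (x : ℂ) (ρ R : ℝ), 0 < ρ → ρ < R →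
      SAW.law D.carrier δ (a δ) (b δ)
        {γ | (⟨γ.walk.toCurve (meshPoint δ)⟩ : Curve ℂ).HasTraversals (k ρ R) x ρ R}
          ≤ ENNReal.ofReal (1 * (ρ / R) ^ (3 : ℝ)) :=
  Theorems.ShellCrossingBound.Negative.radiiThreshold_of_eventualTight hT D a b hab

/-! ## §3 Load-bearing analysis: which hypotheses / side conditions matter -/

/-- The crux with the Aizenman–Burchard dress removed: ANY `K > 0`, ANY real exponent `λ`, no
mesh lower bound on `ρ` (only `0 < ρ`), no `R ≤ 1`. A formally much STRONGER statement.
[folklore] -/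
def ShellCrossingBoundAnyExponent : Prop :=
  ∀ (D : DobrushinDomain) (a b : ℝ → Site 2), SAW.IsEndpointApprox D a b →
    ∃ δ₀ : ℝ, 0 < δ₀ ∧ ∀ (K lam : ℝ), 0 < K → ∃ (k : ℂ → ℝ → ℝ → ℕ),
      ∀ δ ∈ Set.Ioc (0 : ℝ) δ₀, ∀ (x : ℂ) (ρ R : ℝ), 0 < ρ → ρ < R →
        SAW.law D.carrier δ (a δ) (b δ)
          {γ | (⟨γ.walk.toCurve (meshPoint δ)⟩ : Curve ℂ).HasTraversals (k x ρ R) x ρ R}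
            ≤ ENNReal.ofReal (K * (ρ / R) ^ lam)

/-- … which is still implied by the target: the side conditions `δ ≤ ρ`, `R ≤ 1`, `2 < λ` and
the size of `K` are NOT load-bearing. [folklore] -/
theorem anyExponent_of_eventualTight (hT : EventualTight) : ShellCrossingBoundAnyExponent := by
  intro D a b hab
  obtain ⟨δ₀, hδ₀, H⟩ := anyTarget_of_eventualTight hT D a b hab
  refine ⟨δ₀, hδ₀, fun K lam hK => ?_⟩
  obtain ⟨k, hk⟩ := H (fun x ρ R => ENNReal.ofReal (K * (ρ / R) ^ lam)) (by
    intro x ρ R hρ hρR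
    have hR : 0 < R := hρ.trans hρR
    have : 0 < K * (ρ / R) ^ lam := mul_pos hK (Real.rpow_pos_of_pos (div_pos hρ hR) _)
    exact (ENNReal.ofReal_pos.2 this).ne')
  exact ⟨k, hk⟩

/-- … and implies the crux back (specialise `K = 1`, `λ = 3`). [folklore] -/
theorem shellCrossingBound_of_anyExponent (h : ShellCrossingBoundAnyExponent) : ShellCrossingBound := by
  intro D a b hab
  obtain ⟨δ₀, hδ₀, H⟩ := h D a b hab
  obtain ⟨k, hk⟩ := H 1 3 one_pos
  refine ⟨k, 1, 3, δ₀, by norm_num, hδ₀, fun δ hδ x ρ R hδρ hρR _ => ?_⟩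
  exact hk δ hδ x ρ R (hδ.1.trans_le hδρ) hρR

/-- The crux with its only external hypothesis `IsEndpointApprox` DROPPED (endpoint functions
arbitrary). [folklore] -/
def ShellCrossingBoundWithoutApprox : Prop :=
  ∀ (D : DobrushinDomain) (a b : ℝ → Site 2),
    ∃ (k : ℂ → ℝ → ℝ → ℕ) (K lam δ₀ : ℝ), 2 < lam ∧ 0 < δ₀ ∧ ∀ δ ∈ Set.Ioc (0 : ℝ) δ₀,
      ∀ (x : ℂ) (ρ R : ℝ), δ ≤ ρ → ρ < R → R ≤ 1 →
        SAW.law D.carrier δ (a δ) (b δ)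
          {γ | (⟨γ.walk.toCurve (meshPoint δ)⟩ : Curve ℂ).HasTraversals (k x ρ R) x ρ R}
            ≤ ENNReal.ofReal (K * (ρ / R) ^ lam)

/-- Tightness of the critical SAW laws for ARBITRARY endpoint functions (no approximation of
the marked points): the natural companion of `EventualTight`, equally predicted by the
SLE₈⸝₃ picture (interior or erratic endpoints change the limit object, not precompactness).
[folklore] -/
def TightAllEndpoints : Prop :=
  ∀ (D : DobrushinDomain) (a b : ℝ → Site 2), ∃ δ₀ : ℝ, 0 < δ₀ ∧
    IsTightMeasureSet ((fun δ => (SAW.law D.carrier δ (a δ) (b δ)).map (fun γ => γ.curve)) ''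
      Set.Ioc 0 δ₀)

/-- Dropping `IsEndpointApprox` does not expose the crux to junk: the approximation-free version
is still implied by (approximation-free) tightness, by the same sandwich. So no
`_false_without_IsEndpointApprox` theorem can exist short of refuting SAW tightness for some
endpoint choice. (Coincident endpoints `a δ = b δ` give the Dirac mass at a constant curve,
which traverses no genuine shell — `Curve.not_hasTraversals_const`; unreachable endpoints give
the zero law.) [folklore] -/
theorem withoutApprox_of_tightAllEndpoints (hT : TightAllEndpoints) :
    ShellCrossingBoundWithoutApprox := by
  intro D a b
  obtain ⟨δ₀, hδ₀, htight⟩ := hT D a b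
  obtain ⟨k, hk⟩ := targets_of_isTightMeasureSet D.carrier a b _ htight
    (fun x ρ R => ENNReal.ofReal (1 * (ρ / R) ^ (3 : ℝ))) (by
      intro x ρ R hρ hρR
      have hR : 0 < R := hρ.trans hρR
      have : 0 < 1 * (ρ / R) ^ (3 : ℝ) := by
        rw [one_mul]
        exact Real.rpow_pos_of_pos (div_pos hρ hR) _
      exact (ENNReal.ofReal_pos.2 this).ne')
  refine ⟨k, 1, 3, δ₀, by norm_num, hδ₀, fun δ hδ x ρ R hδρ hρR _ => ?_⟩
  exact hk δ hδ x ρ R (hδ.1.trans_le hδρ) hρR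

/-! ## §4 Natural strengthenings -/

/-- The literal Aizenman–Burchard hypothesis (H1): a threshold `k : ℕ` INDEPENDENT of the
shell. [folklore] -/
def ShellCrossingBoundUniformK : Prop :=
  ∀ (D : DobrushinDomain) (a b : ℝ → Site 2), SAW.IsEndpointApprox D a b →
    ∃ (k : ℕ) (K lam δ₀ : ℝ), 2 < lam ∧ 0 < δ₀ ∧ ∀ δ ∈ Set.Ioc (0 : ℝ) δ₀,
      ∀ (x : ℂ) (ρ R : ℝ), δ ≤ ρ → ρ < R → R ≤ 1 →
        SAW.law D.carrier δ (a δ) (b δ)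
          {γ | (⟨γ.walk.toCurve (meshPoint δ)⟩ : Curve ℂ).HasTraversals k x ρ R}
            ≤ ENNReal.ofReal (K * (ρ / R) ^ lam)

/-- The uniform threshold trivially implies the crux. [folklore] -/
theorem shellCrossingBound_of_uniformK (h : ShellCrossingBoundUniformK) : ShellCrossingBound := by
  intro D a b hab
  obtain ⟨k, K, lam, δ₀, hlam, hδ₀, H⟩ := h D a b hab
  exact ⟨fun _ _ _ => k, K, lam, δ₀, hlam, hδ₀, H⟩

/-- The geometric witness property isolating what a refutation of `ShellCrossingBoundUniformK`
needs from the domain: for every `k` and every `ε > 0` a genuine shell of aspect ratio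
`ρ/R < ε` (`R ≤ 1`) and a mesh threshold `δ₁ ≤ ρ` below which the SAW law is a probability
measure and EVERY self-avoiding walk of `Ω_δ` from `a δ` to `b δ` makes `k` separate traversals
of the shell (deterministic boundary forcing). [folklore] -/
def HasForcingCorridors (D : DobrushinDomain) (a b : ℝ → Site 2) : Prop :=
  ∀ (k : ℕ) (ε : ℝ), 0 < ε → ∃ (x : ℂ) (ρ R δ₁ : ℝ), 0 < δ₁ ∧ δ₁ ≤ ρ ∧ ρ < R ∧ R ≤ 1 ∧
    ρ / R < ε ∧ ∀ δ ∈ Set.Ioc (0 : ℝ) δ₁,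
      IsProbabilityMeasure (SAW.law D.carrier δ (a δ) (b δ)) ∧
      ∀ γ : SAW.DomainSAW D.carrier δ (a δ) (b δ),
        (⟨γ.walk.toCurve (meshPoint δ)⟩ : Curve ℂ).HasTraversals k x ρ R

/-- **Reduction of `¬ ShellCrossingBoundUniformK` to a geometric construction** (proved): a
Dobrushin domain with an endpoint approximation having forcing corridors at every aspect ratio
refutes the uniform-threshold statement — given `k, K, λ > 2, δ₀`, pick `ε ≤ 1` with `K ε² < 1`
and the forcing shell for `(k, ε)`; at `δ = min δ₀ δ₁` the event has probability
`1 > K (ρ/R)^λ` (as `(ρ/R)^λ ≤ (ρ/R)^2 < ε²`). With a SHELL-DEPENDENT threshold the same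
forcing is harmless (`k(S)` := forced count `+ …`), which is the whole point of §2. [folklore] -/
theorem not_uniformK_of_forcing (hex : ∃ (D : DobrushinDomain) (a b : ℝ → Site 2),
      SAW.IsEndpointApprox D a b ∧ HasForcingCorridors D a b) :
    ¬ ShellCrossingBoundUniformK := by
  intro hU
  obtain ⟨D, a, b, hab, hF⟩ := hex
  obtain ⟨k, K, lam, δ₀, hlam, hδ₀, H⟩ := hU D a b hab
  -- choose ε with K ε² < 1 and ε ≤ 1
  set ε : ℝ := min 1 (1 / (2 * (max K 1))) with hε
  have hK1 : 1 ≤ max K 1 := le_max_right _ _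
  have hε0 : 0 < ε := lt_min one_pos (by positivity)
  have hε1 : ε ≤ 1 := min_le_left _ _
  have hKε : K * ε ^ 2 < 1 := by
    have h1 : ε ≤ 1 / (2 * max K 1) := min_le_right _ _
    have h2 : K ≤ max K 1 := le_max_left _ _
    have h3 : ε ^ 2 ≤ ε * (1 / (2 * max K 1)) := by
      rw [sq]; exact mul_le_mul_of_nonneg_left h1 hε0.le
    calc K * ε ^ 2 ≤ max K 1 * (ε * (1 / (2 * max K 1))) :=
          mul_le_mul h2 h3 (sq_nonneg _) (by positivity)
      _ = ε / 2 := by field_simp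
      _ < 1 := by linarith
  obtain ⟨x, ρ, R, δ₁, hδ₁, hδ₁ρ, hρR, hR1, hratio, hforce⟩ := hF k ε hε0
  have hρ : 0 < ρ := hδ₁.trans_le hδ₁ρ
  have hR : 0 < R := hρ.trans hρR
  set δ : ℝ := min δ₀ δ₁ with hδ
  have hδpos : 0 < δ := lt_min hδ₀ hδ₁
  have hδmem₀ : δ ∈ Set.Ioc (0 : ℝ) δ₀ := ⟨hδpos, min_le_left _ _⟩
  have hδmem₁ : δ ∈ Set.Ioc (0 : ℝ) δ₁ := ⟨hδpos, min_le_right _ _⟩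
  have hδρ : δ ≤ ρ := (min_le_right _ _).trans hδ₁ρ
  obtain ⟨hprob, hall⟩ := hforce δ hδmem₁
  have hbound := H δ hδmem₀ x ρ R hδρ hρR hR1
  -- the event is everything, so its probability is 1
  have hev : {γ : SAW.DomainSAW D.carrier δ (a δ) (b δ) |
      (⟨γ.walk.toCurve (meshPoint δ)⟩ : Curve ℂ).HasTraversals k x ρ R} = Set.univ :=
    Set.eq_univ_of_forall fun γ => hall γ
  rw [hev, measure_univ] at hbound
  -- but `K (ρ/R)^λ < 1`
  have hq0 : 0 < ρ / R := div_pos hρ hR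
  have hq1 : ρ / R < 1 := (div_lt_one hR).2 hρR
  have hpow : (ρ / R) ^ lam ≤ (ρ / R) ^ (2 : ℝ) :=
    Real.rpow_le_rpow_of_exponent_ge hq0 hq1.le hlam.le
  have hsq : (ρ / R) ^ (2 : ℝ) < ε ^ 2 := by
    rw [Real.rpow_two]
    exact pow_lt_pow_left₀ hratio hq0.le two_ne_zero
  have hlt : K * (ρ / R) ^ lam < 1 := by
    by_cases hK : 0 ≤ K
    · calc K * (ρ / R) ^ lam ≤ K * (ρ / R) ^ (2 : ℝ) := mul_le_mul_of_nonneg_left hpow hK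
        _ ≤ K * ε ^ 2 := mul_le_mul_of_nonneg_left hsq.le hK
        _ < 1 := hKε
    · have : K * (ρ / R) ^ lam ≤ 0 :=
        mul_nonpos_of_nonpos_of_nonneg (le_of_not_ge hK) (Real.rpow_nonneg hq0.le _)
      linarith
  have : ENNReal.ofReal (K * (ρ / R) ^ lam) < 1 := by
    rw [← ENNReal.ofReal_one]
    exact (ENNReal.ofReal_lt_ofReal_iff one_pos).2 hlt
  exact absurd hbound (not_le.2 this)

/-- **A Dobrushin domain with forcing corridors exists** (PROVED; construction landed as
`Theorems/ShellCrossingBound/Negative/Forcing1Domain … Forcing6Shell.lean`): the sheared triangle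
`Negative.Forcing.forcingDomain` with the endpoint approximation `Negative.Forcing.aδ, bδ`. Also landed:
`Negative.not_uniformThreshold` (`UniformThresholdFalse.lean`, statement inlined). [folklore] -/
theorem exists_hasForcingCorridors :
    ∃ (D : DobrushinDomain) (a b : ℝ → Site 2), SAW.IsEndpointApprox D a b ∧ HasForcingCorridors D a b :=
  ⟨Theorems.ShellCrossingBound.Negative.Forcing.forcingDomain,
    Theorems.ShellCrossingBound.Negative.Forcing.aδ, Theorems.ShellCrossingBound.Negative.Forcing.bδ,
    Theorems.ShellCrossingBound.Negative.Forcing.isEndpointApprox,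
    fun k _ hε => Theorems.ShellCrossingBound.Negative.Forcing.forcing k hε⟩

/-- **The literal AB (H1) with a uniform threshold is FALSE for the critical SAW in general
Dobrushin domains** (sorry-free). [folklore] -/
theorem not_shellCrossingBoundUniformK : ¬ ShellCrossingBoundUniformK :=
  not_uniformK_of_forcing exists_hasForcingCorridors

/-! ## §5 Repair candidates for the planner: a crux with content beyond T′ -/

/-- REPAIR CANDIDATE (bulk half): **Aizenman–Burchard (H1) proper on interior shells** — ONE
threshold `k₀ : ℕ` for all shells whose closed outer ball lies inside `Ω`. Not implied by
`EventualTight` (uniformity in the shell is real content: it is what AB99 Thms 1.1–1.3 turn into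
Hölder regularity and dimension bounds `< 2` of the limit), immune to boundary forcing (inside
`closedBall x R ⊆ Ω` the walk moves freely, so no traversal of `D(x; ρ, R)` is ever forced), and
predicted true with `k₀ = 4` (polymer exponent `x₄ = 35/12 > 2`; `x₆ = 20/3`) and predicted
FALSE with `k₀ = 3`: `IsEndpointApprox` lets `a_δ` sit at distance `d_δ ≫ δ` from `∂Ω`, and for the
bulk shells `D(δ·a_δ; ρ, R)`, `δ ≤ ρ < R < d_δ`, centred at the starting point, three traversals
cost only one return of the walk to its origin, `P ≍ (ρ/R)^{x₃ − x₁} = (ρ/R)^{3/2}` (Duplantier–Saleur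
`x_L = (9L² − 4)/48`), slower than any `λ > 2`; four traversals force five legs at the origin,
`(ρ/R)^{9/2}`. So the minimal admissible uniform threshold is `4`, and a prover should not try
`k₀ ≤ 3`. This is the statement the surgery `AnnularMassDecay → TubeLowerBound → …` should be
aimed at. [folklore] -/
def ShellCrossingBoundBulk : Prop :=
  ∀ (D : DobrushinDomain) (a b : ℝ → Site 2), SAW.IsEndpointApprox D a b →
    ∃ (k₀ : ℕ) (K lam δ₀ : ℝ), 2 < lam ∧ 0 < δ₀ ∧ ∀ δ ∈ Set.Ioc (0 : ℝ) δ₀,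
      ∀ (x : ℂ) (ρ R : ℝ), δ ≤ ρ → ρ < R → R ≤ 1 → Metric.closedBall x R ⊆ D.carrier →
        SAW.law D.carrier δ (a δ) (b δ)
          {γ | (⟨γ.walk.toCurve (meshPoint δ)⟩ : Curve ℂ).HasTraversals k₀ x ρ R}
            ≤ ENNReal.ofReal (K * (ρ / R) ^ lam)

/-- REPAIR CANDIDATE (boundary half): the crux restricted to shells MEETING the complement of
`Ω`, with the shell-dependent threshold (here the freedom is needed, §4). Implied by
`EventualTight` (§2) but, unlike the full crux, not equivalent to it (it says nothing about bulk
shells). [folklore] -/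
def ShellCrossingBoundBoundary : Prop :=
  ∀ (D : DobrushinDomain) (a b : ℝ → Site 2), SAW.IsEndpointApprox D a b →
    ∃ (k : ℂ → ℝ → ℝ → ℕ) (K lam δ₀ : ℝ), 2 < lam ∧ 0 < δ₀ ∧ ∀ δ ∈ Set.Ioc (0 : ℝ) δ₀,
      ∀ (x : ℂ) (ρ R : ℝ), δ ≤ ρ → ρ < R → R ≤ 1 → ¬ Metric.closedBall x R ⊆ D.carrier →
        SAW.law D.carrier δ (a δ) (b δ)
          {γ | (⟨γ.walk.toCurve (meshPoint δ)⟩ : Curve ℂ).HasTraversals (k x ρ R) x ρ R}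
            ≤ ENNReal.ofReal (K * (ρ / R) ^ lam)

/-- The boundary half is implied by the target (same sandwich as §2). [folklore] -/
theorem boundary_of_eventualTight (hT : EventualTight) : ShellCrossingBoundBoundary := by
  intro D a b hab
  obtain ⟨k, K, lam, δ₀, hlam, hδ₀, H⟩ := shellCrossingBound_of_eventualTight hT D a b hab
  exact ⟨k, K, lam, δ₀, hlam, hδ₀, fun δ hδ x ρ R h1 h2 h3 _ => H δ hδ x ρ R h1 h2 h3⟩

/-- **The split is sound**: bulk half (uniform threshold) and boundary half (shell-dependent
threshold) together give the crux — glue the thresholds by `max`, the constants by `max`, the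
exponents by `min` (`ρ/R < 1`). So `route edit --split ShellCrossingBound --into
ShellCrossingBoundBulk ShellCrossingBoundBoundary` would keep the assembly intact while giving r2 a
content-bearing component. [folklore] -/
theorem shellCrossingBound_of_bulk_of_boundary (hB : ShellCrossingBoundBulk)
    (hBd : ShellCrossingBoundBoundary) : ShellCrossingBound := by
  intro D a b hab
  obtain ⟨k₀, K₁, lam₁, δ₁, hlam₁, hδ₁, H₁⟩ := hB D a b hab
  obtain ⟨k, K₂, lam₂, δ₂, hlam₂, hδ₂, H₂⟩ := hBd D a b hab
  refine ⟨fun x ρ R => max k₀ (k x ρ R), max K₁ K₂, min lam₁ lam₂, min δ₁ δ₂,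
    lt_min hlam₁ hlam₂, lt_min hδ₁ hδ₂, fun δ hδ x ρ R hδρ hρR hR1 => ?_⟩
  have hρ : 0 < ρ := hδ.1.trans_le hδρ
  have hR : 0 < R := hρ.trans hρR
  have hq0 : 0 < ρ / R := div_pos hρ hR
  have hq1 : ρ / R ≤ 1 := ((div_lt_one hR).2 hρR).le
  -- the common bound dominates both individual bounds
  have hdom : ∀ (K' lam' : ℝ), K' ≤ max K₁ K₂ → min lam₁ lam₂ ≤ lam' →
      ENNReal.ofReal (K' * (ρ / R) ^ lam') ≤
        ENNReal.ofReal (max K₁ K₂ * (ρ / R) ^ min lam₁ lam₂) := by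
    intro K' lam' hK' hlam'
    by_cases hK'0 : 0 ≤ K'
    · apply ENNReal.ofReal_le_ofReal
      calc K' * (ρ / R) ^ lam' ≤ K' * (ρ / R) ^ min lam₁ lam₂ :=
            mul_le_mul_of_nonneg_left (Real.rpow_le_rpow_of_exponent_ge hq0 hq1 hlam') hK'0
        _ ≤ max K₁ K₂ * (ρ / R) ^ min lam₁ lam₂ :=
            mul_le_mul_of_nonneg_right hK' (Real.rpow_nonneg hq0.le _)
    · rw [ENNReal.ofReal_of_nonpos (mul_nonpos_of_nonpos_of_nonneg (not_le.1 hK'0).le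
        (Real.rpow_nonneg hq0.le _))]
      exact zero_le
  by_cases hbulk : Metric.closedBall x R ⊆ D.carrier
  · have hδ' : δ ∈ Set.Ioc (0 : ℝ) δ₁ := ⟨hδ.1, hδ.2.trans (min_le_left _ _)⟩
    calc SAW.law D.carrier δ (a δ) (b δ)
          {γ | (⟨γ.walk.toCurve (meshPoint δ)⟩ : Curve ℂ).HasTraversals (max k₀ (k x ρ R)) x ρ R}
        ≤ SAW.law D.carrier δ (a δ) (b δ)
          {γ | (⟨γ.walk.toCurve (meshPoint δ)⟩ : Curve ℂ).HasTraversals k₀ x ρ R} :=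
          measure_mono fun γ hγ => Curve.HasTraversals.of_le hγ (le_max_left _ _)
      _ ≤ ENNReal.ofReal (K₁ * (ρ / R) ^ lam₁) := H₁ δ hδ' x ρ R hδρ hρR hR1 hbulk
      _ ≤ _ := hdom K₁ lam₁ (le_max_left _ _) (min_le_left _ _)
  · have hδ' : δ ∈ Set.Ioc (0 : ℝ) δ₂ := ⟨hδ.1, hδ.2.trans (min_le_right _ _)⟩
    calc SAW.law D.carrier δ (a δ) (b δ)
          {γ | (⟨γ.walk.toCurve (meshPoint δ)⟩ : Curve ℂ).HasTraversals (max k₀ (k x ρ R)) x ρ R}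
        ≤ SAW.law D.carrier δ (a δ) (b δ)
          {γ | (⟨γ.walk.toCurve (meshPoint δ)⟩ : Curve ℂ).HasTraversals (k x ρ R) x ρ R} :=
          measure_mono fun γ hγ => Curve.HasTraversals.of_le hγ (le_max_right _ _)
      _ ≤ ENNReal.ofReal (K₂ * (ρ / R) ^ lam₂) := H₂ δ hδ' x ρ R hδρ hρR hR1 hbulk
      _ ≤ _ := hdom K₂ lam₂ (le_max_right _ _) (min_le_right _ _)

/-! ## §5b (cycle 2) The bulk repair needs a threshold `k₀ ≥ 3`: `k₀ ≤ 2` is FALSE, estimate-free (LANDED: `Negative/BulkEndpoint.lean` p80596, `Negative/BulkThresholdTwo.lean` p81467) -/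

/-- The bulk repair candidate with its threshold DISPLAYED: `ShellCrossingBoundBulk` is
`∀ (D, a, b), ∃ k₀, …`; a proof producing the threshold `k₀` for every `(D, a, b)` proves
`ShellCrossingBoundBulkAt k₀`. [folklore] -/
def ShellCrossingBoundBulkAt (k₀ : ℕ) : Prop :=
  ∀ (D : DobrushinDomain) (a b : ℝ → Site 2), SAW.IsEndpointApprox D a b →
    ∃ (K lam δ₀ : ℝ), 2 < lam ∧ 0 < δ₀ ∧ ∀ δ ∈ Set.Ioc (0 : ℝ) δ₀,
      ∀ (x : ℂ) (ρ R : ℝ), δ ≤ ρ → ρ < R → R ≤ 1 → Metric.closedBall x R ⊆ D.carrier →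
        SAW.law D.carrier δ (a δ) (b δ)
          {γ | (⟨γ.walk.toCurve (meshPoint δ)⟩ : Curve ℂ).HasTraversals k₀ x ρ R}
            ≤ ENNReal.ofReal (K * (ρ / R) ^ lam)

/-- A fixed threshold gives the bulk statement. [folklore] -/
theorem shellCrossingBoundBulk_of_bulkAt {k₀ : ℕ} (h : ShellCrossingBoundBulkAt k₀) :
    ShellCrossingBoundBulk := by
  intro D a b hab
  obtain ⟨K, lam, δ₀, hlam, hδ₀, H⟩ := h D a b hab
  exact ⟨k₀, K, lam, δ₀, hlam, hδ₀, H⟩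

/-- Monotonicity in the threshold (more traversals are rarer). [folklore] -/
theorem ShellCrossingBoundBulkAt.mono {j k : ℕ} (hjk : j ≤ k) (h : ShellCrossingBoundBulkAt j) :
    ShellCrossingBoundBulkAt k := by
  intro D a b hab
  obtain ⟨K, lam, δ₀, hlam, hδ₀, H⟩ := h D a b hab
  refine ⟨K, lam, δ₀, hlam, hδ₀, fun δ hδ x ρ R h1 h2 h3 h4 => le_trans ?_ (H δ hδ x ρ R h1 h2 h3 h4)⟩
  exact measure_mono fun γ hγ => Curve.HasTraversals.of_le hγ hjk

/-- **The bulk repair with a fixed threshold `k₀ ≤ 2` is FALSE** (cycle 2; estimate-free).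
Witness (`Theorems/ShellCrossingBound/Negative/BulkEndpoint.lean` + `BulkThresholdTwo.lean`, p80596 + p81467, namespace `Negative.Bulk`):
cycle 1's `forcingDomain` with the endpoint approximation `(aδ, bInt)`, where `bInt δ` is an
INTERIOR lattice point at distance `≍ √δ` from `∂Ω` converging to `b = 1 − i/4` (legal:
`IsEndpointApprox` only asks `δ·b_δ → b`); every SAW polyline ends at `q = δ·bInt δ`, so it crosses
the circle `|z − q| = √δ/16` (`exists_dist_eq`) and passes within `δ` of one of the `≤ 324/u²`
points of the grid of step `δ/2` about `q` (`exists_mem_grid_dist_le`), making two separate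
traversals of the interior shell `D(x; δ, √δ/32) ⊆ closedBall q (√δ/2) ⊆ Ω`
(`exists_hasTraversals_two`, `closedBall_bInt_subset`); union bound:
`1 = P(univ) ≤ Σ_x P[2 traversals at x] ≤ 324 K u^{λ−2}` with `u = 32√δ → 0`, `λ > 2`.
Consequences: (i) the minimal fixed bulk threshold is `≥ 3` (predicted `4`: `k₀ = 3` fails
conjecturally at the interior start, `(ρ/R)^{x₃−x₁} = (ρ/R)^{3/2}`); (ii) the latitude of
`IsEndpointApprox` (interior endpoints) is LOAD-BEARING for every fixed-threshold statement — the
alternative repair guards the marked points (`dist x (D.pt i) ≥ d`, constants depending on `d`,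
as in the pinch line's `UTSP`), which absorbs this witness. [folklore] -/
theorem not_shellCrossingBoundBulkAt_of_le_two {k₀ : ℕ} (hk : k₀ ≤ 2) :
    ¬ ShellCrossingBoundBulkAt k₀ :=
  Theorems.ShellCrossingBound.Negative.Bulk.not_bulkThreshold_of_le_two hk

/-- In particular no proof of `ShellCrossingBoundBulk` can exhibit the threshold `2` (or `1`, or
`0`) uniformly in `(D, a, b)`. [folklore] -/
theorem not_shellCrossingBoundBulkAt_two : ¬ ShellCrossingBoundBulkAt 2 :=
  not_shellCrossingBoundBulkAt_of_le_two le_rfl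

/-! ## Targets (cycle 2 addendum): the lead PICKED `socket-comparison` (PICKED.md, 2026-08-16T04:06Z) — cheap attacks on its four stubs

Registered stubs of `Lines/socket-comparison.lean` (statements over tree vocabulary), attacked with the
standing witnesses of this file (boundary forcing §4, interior endpoints §5b, sub-mesh, necks,
largest-component junk). Verdict: NO STUB IS CHEAPLY FALSE; S1, S2 provable; S4, S5 honest open
estimates. Details, per stub:

* `stub_travCount` (S1, deterministic): TRUE by convexity — along one lattice edge the distance to
  `x` is convex, so two separate inward traversals cannot END on the same edge (the later one starts
  at distance `≥ R` between two points at distance `≤ ρ` of that edge) and dually for outward ones;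
  a self-avoiding polyline uses each of the `≤ 4(2ρ/δ₁+3)²` edges of `δℤ²` meeting `B̄(x, ρ)` at
  most once, uniformly in `δ ≥ δ₁` (for `δ ≫ ρ` at most `O(1)` edges meet the ball); take
  `N = 2 · #edges + 1 ≥ 1` (`N = 0` would be the only junk: `HasTraversals 0 = True`). Nil walks
  give constant curves (no traversal). No kill.
* `stub_socketNesting` (S2): TRUE for small `δ`. The component `K' = meshDomain D' δ` is connected
  in the mesh graph of `Ω = D' ∪ (B(0,L) ∖ plugs)` (edges: segment ⊆ closure D' ⊆ closure Ω), so it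
  lies in one component `K`; `K'` contains a mesh point of `D' ∖ plugs` (area of `D' ∖ plugs` ≥
  `6rw > 2rw ≥` area inside the plugs for a snake of width `w`; giant component of a Jordan domain),
  the mesh points of the smooth region `B(0,L) ∖ plugs` are connected for `δ ≪ r` (near a plug
  boundary one of the four axis steps points outward: `|p + te − a|² ≥ |p − a|² > r²` when
  `(p − a)·e ≥ 0`), hence all lie in `K`, and every other component sits inside the plugs with
  `≤ 2πr²/δ² < |K|` vertices: `K` is the largest, `Nested` holds. The only junk (ties / coarse `δ`)
  is excluded by `∃ δ₁`. No kill; difficulty as the lead says (L, lattice topology).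
* `stub_socketConfinement` (S4, OPEN rate-free): no junk — for `δ ∈ [δ₁, δ₀]` the ratio
  `Z_{D'}/Z_Ω ≥ x_c^{N_max}/#walks > 0` uniformly (bounded vertex count), interior endpoints are
  harmless (Ω and D' coincide inside the socket balls, where `a_δ, b_δ` live for small `δ`), and the
  law of `Ω_δ` is a probability measure once S2's nesting holds (`δ₀ ≤ δ₁`). Content = SLE₈⸝₃
  restriction: `Z_{D'}/Z_Ω → (H_{D'}(a,b)/H_Ω(a,b))^{5/8} > 0` conjecturally (lattice factors at the
  sockets cancel — the point of the socket move). Not refutable cheaply; not provable cheaply.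
* `stub_socketPinchBound` (S5, OPEN hardest): IMMUNE to all four standing witnesses — boundary
  forcing needs necks, and `Ω` outside the plugs is a disc minus two round holes (no necks; the wild
  part of `∂D'` is inside the plugs, `≥ 3r − R₀ − r ≥ r` away from every admissible shell);
  interior endpoints: `δ₀` is chosen after `r`, so `δ·a_δ ∈ B(a, r)` and admissible shells stay
  `≥ r` away from both lattice endpoints; sub-mesh: clause `δ ≤ η`; moderate `δ`: ratio `η/R ≥ δ/R₀`
  absorbed by `C`. Predicted exponents `35/12` (bulk), `7` (round boundary) vs required `> 1`: wide
  margin. S5 = `UTSP` in the nicest domain = a genuine 4-arm upper bound for the critical ℤ² SAW,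
  open on every lattice; no cheap kill exists and none is expected. (If the lead's `R₀ ≤ r` choice
  is dropped, shells could touch the plugs and boundary forcing inside `D' ∩ plug` returns — keep it.)
* Reserve lines (scanned in case the lead switches): `pinch-on-a-circle` — `stub_subMeshNoPinch`
  TRUE (for `η < δ/4` every edge meeting `B̄(y, η)` is incident to one vertex `v`, a SAW uses `≤ 2`
  of them consecutively, the L-turn double visit stays within `√2 η < 2η < R`, so `≤ 2` traversals);
  `stub_bulkTwoStrandPinch` (bulk, `k = 4`, NO marked-point guard, NO mesh clause) survives the
  interior-endpoint witness exactly because `k = 4` at a shell containing the lattice endpoint needs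
  five level crossings (two returns, predicted `(η/R)^{x₅−x₁} = (η/R)^{9/2}`) — it would be FALSE
  with `k ≤ 2` by §5b's argument verbatim, and is predicted false with `k = 3`;
  `stub_confinementPositivity` / `stub_socketedEnlargement`: junk only at coarse `δ` (excluded by
  `∃ δ₀`) resp. a true-but-heavy Jordan construction. `kesten-defect-renewal` — tilted Kraft holds
  at `W = 1` iff `c ≤ log μ` (prover's `c`), widths `2, 3` checked by triage; the glue
  `stub_eventualTight_of_perShellDecay` is TRUE via `shellCrossingBound_of_perShellTight`-style
  thresholds `ε = (ρ/R)³` + item 4732. No cheap kill on any reserve stub.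
-/


end Summit.CriticalPhenomena.SAWScalingLimit.Cruxes.ShellCrossingBound.Disproof

end
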